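import Summits.CriticalPhenomena.PercolationContinuityZ3.Theorems.SahiBoxTP2HolleyTwoMeasures
import Summits.CriticalPhenomena.PercolationContinuityZ3.Theorems.SahiIsingHolley

/-!
# Holley's inequality for two measures on `{−1,+1}^ι`, density-free: the cross cylinder-box condition implies
# stochastic domination on all cylinder (local) increasing events and functionals

Support file of the Sahi cell (`prim-sahi`, typer seat, generation 15; `--supports stmt-CriticalPhenomena-4575`).
Theorems only (no definitions, no named facts, no sorries).  The `{−1,+1}^ι` companion of
`SahiBoxTP2HolleyTwoMeasures.lean` (cube): two finite measures `μ₁, μ₂` on `{−1,+1}^ι` (`ι` countable; infinite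
volume allowed, singular allowed) satisfying the CROSS BOX CONDITION
`μ₁[a,b] μ₂[a',b'] ≤ μ₁[a ∧ a', b ∧ b'] μ₂[a ∨ a', b ∨ b']` for all order boxes (on `{−1,+1}^ι` these are exactly the
finite-window cylinder conditions `μ₁(σ_J = η) μ₂(σ_J = η') ≤ μ₁(σ_J = η ∧ η') μ₂(σ_J = η ∨ η')` — Holley's 1974
hypothesis for every window marginal) are stochastically ordered on every LOCAL increasing event / functional:

* `crossFiber_glue_restrict_of_crossBox` — cross box condition ⇒ cross fibre condition for the window truncations;
* **`holley_local_upperSet_of_crossBox_spin`** — `μ₁(U) μ₂(Ω) ≤ μ₁(Ω) μ₂(U)` for every increasing event `U`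
  depending on finitely many spins; **`holley_local_integral_of_crossBox_spin`** — `(∫ h dμ₁) μ₂(Ω) ≤ μ₁(Ω) (∫ h dμ₂)`
  for every bounded increasing local `h`; `holley_local_of_crossBox_spin` (probability measures: `∫ h dμ₁ ≤ ∫ h dμ₂`).

(Finite strictly positive weights: Holley 1974 / Grimmett RCM Thm. 2.1, tree `HolleyCriterion.lean`; here no
positivity, infinite `ι`, via the two-measure density-free four functions theorem `fourFunctions_of_fiber₂`.)

No sorries, no new axioms.
-/

noncomputable section

namespace Summit.CriticalPhenomena.PercolationContinuityZ3.Theorems.SahiBoxTP2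

open MeasureTheory Set Filter Topology Function
open Literature.Probability.LatticeModels
open scoped ENNReal

/-! ### Layer cake with the hypothesis on the level sets only -/

section LevelSets

variable {Ω : Type*} [MeasurableSpace Ω]

/-- Layer cake, `[0,∞]` form, hypothesis on the super-level sets of `f` only. [folklore] -/
theorem lintegral_mul_le_mul_lintegral_of_levelSets (ν₁ ν₂ : Measure Ω) [IsFiniteMeasure ν₁] [IsFiniteMeasure ν₂]
    {f : Ω → ℝ} (hfm : Measurable f) (hf0 : ∀ x, 0 ≤ f x)
    (h : ∀ t : ℝ, ν₁ {x | t < f x} * ν₂ univ ≤ ν₁ univ * ν₂ {x | t < f x}) :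
    (∫⁻ x, ENNReal.ofReal (f x) ∂ν₁) * ν₂ univ ≤ ν₁ univ * ∫⁻ x, ENNReal.ofReal (f x) ∂ν₂ := by
  rw [lintegral_eq_lintegral_meas_lt ν₁ (Eventually.of_forall hf0) hfm.aemeasurable,
    lintegral_eq_lintegral_meas_lt ν₂ (Eventually.of_forall hf0) hfm.aemeasurable,
    ← lintegral_mul_const' _ _ (measure_ne_top _ _), ← lintegral_const_mul' _ _ (measure_ne_top _ _)]
  exact lintegral_mono fun t => h t

/-- **Layer cake with the domination hypothesis on the level sets of `f` only**: if
`ν₁{f > t} ν₂(Ω) ≤ ν₁(Ω) ν₂{f > t}` for all `t`, then `(∫ f dν₁) ν₂(Ω) ≤ ν₁(Ω) (∫ f dν₂)` (`f` bounded measurable,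
any sign). [folklore] -/
theorem integral_mul_le_mul_integral_of_levelSets (ν₁ ν₂ : Measure Ω) [IsFiniteMeasure ν₁] [IsFiniteMeasure ν₂]
    {f : Ω → ℝ} (hfm : Measurable f) {C : ℝ} (hfC : ∀ x, |f x| ≤ C)
    (h : ∀ t : ℝ, ν₁ {x | t < f x} * ν₂ univ ≤ ν₁ univ * ν₂ {x | t < f x}) :
    (∫ x, f x ∂ν₁) * ν₂.real univ ≤ ν₁.real univ * ∫ x, f x ∂ν₂ := by
  set g : Ω → ℝ := fun x => f x + C with hg
  have hg0 : ∀ x, 0 ≤ g x := fun x => by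
    have := hfC x
    rw [abs_le] at this
    simp only [hg]
    linarith [this.1]
  have hgC : ∀ x, |g x| ≤ C + C := fun x => by
    have := hfC x
    rw [abs_le] at this
    rw [abs_of_nonneg (hg0 x)]
    simp only [hg]
    linarith [this.2]
  have hgm : Measurable g := hfm.add_const C
  have hglev : ∀ t : ℝ, ν₁ {x | t < g x} * ν₂ univ ≤ ν₁ univ * ν₂ {x | t < g x} := fun t => by
    have e : {x | t < g x} = {x | t - C < f x} := Set.ext fun x => by simp only [mem_setOf_eq, hg]; constructor <;> intro hx <;> linarith
    rw [e]; exact h (t - C)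
  have hgi : ∀ (ν : Measure Ω) [IsFiniteMeasure ν], Integrable g ν := fun ν _ =>
    Integrable.of_bound hgm.aestronglyMeasurable (C + C) (Eventually.of_forall fun x => by
      rw [Real.norm_eq_abs]; exact hgC x)
  have hfi : ∀ (ν : Measure Ω) [IsFiniteMeasure ν], Integrable f ν := fun ν _ =>
    Integrable.of_bound hfm.aestronglyMeasurable C (Eventually.of_forall fun x => by
      rw [Real.norm_eq_abs]; exact hfC x)
  have key := lintegral_mul_le_mul_lintegral_of_levelSets ν₁ ν₂ hgm hg0 hglev
  rw [← ofReal_integral_eq_lintegral_ofReal (hgi ν₁) (Eventually.of_forall hg0),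
    ← ofReal_integral_eq_lintegral_ofReal (hgi ν₂) (Eventually.of_forall hg0)] at key
  have key' : (∫ x, g x ∂ν₁) * ν₂.real univ ≤ ν₁.real univ * ∫ x, g x ∂ν₂ := by
    have := ENNReal.toReal_mono (ENNReal.mul_ne_top (measure_ne_top _ _) ENNReal.ofReal_ne_top) key
    rwa [ENNReal.toReal_mul, ENNReal.toReal_mul, ENNReal.toReal_ofReal (integral_nonneg hg0),
      ENNReal.toReal_ofReal (integral_nonneg hg0)] at this
  have e1 : ∫ x, g x ∂ν₁ = ∫ x, f x ∂ν₁ + C * ν₁.real univ := by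
    simp only [hg]
    rw [integral_add (hfi ν₁) (integrable_const C), integral_const, smul_eq_mul, mul_comm]
  have e2 : ∫ x, g x ∂ν₂ = ∫ x, f x ∂ν₂ + C * ν₂.real univ := by
    simp only [hg]
    rw [integral_add (hfi ν₂) (integrable_const C), integral_const, smul_eq_mul, mul_comm]
  rw [e1, e2] at key'
  nlinarith [key', measureReal_nonneg (μ := ν₁) (s := univ), measureReal_nonneg (μ := ν₂) (s := univ)]

end LevelSets

section Spins

variable {ι : Type*}

/-- **Cross box condition ⇒ cross fibre condition for the window truncation scheme.** [this work] -/
theorem crossFiber_glue_restrict_of_crossBox [DecidableEq ι] (μ₁ μ₂ : Measure (ι → ℤˣ))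
    (hcross : ∀ a b a' b' : ι → ℤˣ,
      μ₁ (Icc a b) * μ₂ (Icc a' b') ≤ μ₁ (Icc (a ⊓ a') (b ⊓ b')) * μ₂ (Icc (a ⊔ a') (b ⊔ b')))
    (J : Finset ι) (a b : ι → ℤˣ) :
    μ₁ ((fun σ : ι → ℤˣ => glue J (J.restrict σ) .plus) ⁻¹' {a}) *
        μ₂ ((fun σ : ι → ℤˣ => glue J (J.restrict σ) .plus) ⁻¹' {b}) ≤
      μ₁ ((fun σ : ι → ℤˣ => glue J (J.restrict σ) .plus) ⁻¹' {a ⊓ b}) *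
        μ₂ ((fun σ : ι → ℤˣ => glue J (J.restrict σ) .plus) ⁻¹' {a ⊔ b}) := by
  by_cases ha : glue J (J.restrict a) .plus = a
  · by_cases hb : glue J (J.restrict b) .plus = b
    · have hab : glue J (J.restrict (a ⊓ b)) .plus = a ⊓ b := by rw [glue_restrict_inf, ha, hb]
      have hab' : glue J (J.restrict (a ⊔ b)) .plus = a ⊔ b := by rw [glue_restrict_sup, ha, hb]
      rw [preimage_glue_restrict_singleton_of_eq J ha, preimage_glue_restrict_singleton_of_eq J hb,
        preimage_glue_restrict_singleton_of_eq J hab, preimage_glue_restrict_singleton_of_eq J hab',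
        restrict_preimage_singleton_eq_Icc, restrict_preimage_singleton_eq_Icc, restrict_preimage_singleton_eq_Icc,
        restrict_preimage_singleton_eq_Icc, show J.restrict (a ⊓ b) = J.restrict a ⊓ J.restrict b from rfl,
        show J.restrict (a ⊔ b) = J.restrict a ⊔ J.restrict b from rfl, glue_inf, glue_inf, glue_sup, glue_sup]
      exact hcross _ _ _ _
    · rw [preimage_glue_restrict_singleton_of_ne J hb, measure_empty, mul_zero]
      exact zero_le
  · rw [preimage_glue_restrict_singleton_of_ne J ha, measure_empty, zero_mul]
    exact zero_le

variable [Countable ι]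

/-- **Holley for two measures on `{−1,+1}^ι`, local increasing events**: under the cross box condition,
`μ₁(U) μ₂(Ω) ≤ μ₁(Ω) μ₂(U)` for every measurable increasing event `U` depending on a finite window. [this work] -/
theorem holley_local_upperSet_of_crossBox_spin (μ₁ μ₂ : Measure (ι → ℤˣ)) [IsFiniteMeasure μ₁] [IsFiniteMeasure μ₂]
    (hcross : ∀ a b a' b' : ι → ℤˣ,
      μ₁ (Icc a b) * μ₂ (Icc a' b') ≤ μ₁ (Icc (a ⊓ a') (b ⊓ b')) * μ₂ (Icc (a ⊔ a') (b ⊔ b')))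
    (J : Finset ι) {U : Set (ι → ℤˣ)} (hU : IsUpperSet U) (hUm : MeasurableSet U)
    (hUd : DependsOn (fun σ => σ ∈ U) (↑J : Set ι)) : μ₁ U * μ₂ univ ≤ μ₁ univ * μ₂ U := by
  classical
  have hind : ∀ x, 0 ≤ U.indicator (1 : (ι → ℤˣ) → ℝ) x ∧ U.indicator (1 : (ι → ℤˣ) → ℝ) x ≤ 1 := fun x => by
    by_cases hx : x ∈ U
    · simp [indicator_of_mem hx]
    · simp [indicator_of_notMem hx]
  have hdep : DependsOn (U.indicator (1 : (ι → ℤˣ) → ℝ)) (↑J : Set ι) := dependsOn_indicator_of_mem hUd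
  have hreg : ∀ (ν : Measure (ι → ℤˣ)), ∀ᵐ x ∂ν, Tendsto
      (fun _ : ℕ => U.indicator (1 : (ι → ℤˣ) → ℝ) (glue J (J.restrict x) .plus)) atTop
      (𝓝 (U.indicator (1 : (ι → ℤˣ) → ℝ) x)) := fun ν =>
    Eventually.of_forall fun x => by
      simp only [apply_glue_restrict_of_dependsOn hdep]
      exact tendsto_const_nhds
  have key := fourFunctions_of_fiber₂ μ₁ μ₂ (fun _ σ => glue J (J.restrict σ) .plus)
    (fun _ => measurable_glue_restrict J) (fun _ => glue_restrict_inf J) (fun _ => glue_restrict_sup J)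
    (fun _ => finite_range_glue_restrict J) (fun _ => crossFiber_glue_restrict_of_crossBox μ₁ μ₂ hcross J)
    ![U.indicator 1, fun _ => 1, fun _ => 1, U.indicator 1]
    (fun j x => by
      fin_cases j
      · exact (hind x).1
      · exact zero_le_one
      · exact zero_le_one
      · exact (hind x).1)
    (fun j => by
      fin_cases j
      · exact measurable_one.indicator hUm
      · exact measurable_const
      · exact measurable_const
      · exact measurable_one.indicator hUm)
    (C := 1) (fun j x => by
      fin_cases j
      · exact (hind x).2
      · exact le_rfl
      · exact le_rfl
      · exact (hind x).2)
    (hreg μ₁) (Eventually.of_forall fun x => tendsto_const_nhds)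
    (Eventually.of_forall fun x => tendsto_const_nhds) (hreg μ₂)
    (fun x y => by
      show U.indicator (1 : (ι → ℤˣ) → ℝ) x * 1 ≤ 1 * U.indicator (1 : (ι → ℤˣ) → ℝ) (x ⊔ y)
      by_cases hx : x ∈ U
      · rw [indicator_of_mem hx, indicator_of_mem (hU le_sup_left hx), Pi.one_apply, Pi.one_apply]
      · rw [indicator_of_notMem hx, zero_mul]
        exact mul_nonneg zero_le_one (hind _).1)
  change (∫ x, U.indicator (1 : (ι → ℤˣ) → ℝ) x ∂μ₁) * (∫ x, (1 : ℝ) ∂μ₂) ≤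
    (∫ x, (1 : ℝ) ∂μ₁) * (∫ x, U.indicator (1 : (ι → ℤˣ) → ℝ) x ∂μ₂) at key
  simp only [integral_const, smul_eq_mul, mul_one, integral_indicator_one hUm] at key
  -- `key : μ₁.real U * μ₂.real univ ≤ μ₁.real univ * μ₂.real U`
  rw [← ofReal_measureReal (measure_ne_top μ₁ U), ← ofReal_measureReal (measure_ne_top μ₂ univ),
    ← ofReal_measureReal (measure_ne_top μ₁ univ), ← ofReal_measureReal (measure_ne_top μ₂ U),
    ← ENNReal.ofReal_mul measureReal_nonneg, ← ENNReal.ofReal_mul measureReal_nonneg]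
  exact ENNReal.ofReal_le_ofReal key

/-- **Holley for two measures on `{−1,+1}^ι`, local increasing functionals**: `(∫ h dμ₁) μ₂(Ω) ≤ μ₁(Ω) (∫ h dμ₂)`
for every bounded increasing `h` depending on a finite window (layer cake over the local up-sets `{h > t}`).
[this work] -/
theorem holley_local_integral_of_crossBox_spin (μ₁ μ₂ : Measure (ι → ℤˣ)) [IsFiniteMeasure μ₁]
    [IsFiniteMeasure μ₂]
    (hcross : ∀ a b a' b' : ι → ℤˣ,
      μ₁ (Icc a b) * μ₂ (Icc a' b') ≤ μ₁ (Icc (a ⊓ a') (b ⊓ b')) * μ₂ (Icc (a ⊔ a') (b ⊔ b')))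
    (J : Finset ι) {h : (ι → ℤˣ) → ℝ} (hh : Monotone h) (hhd : DependsOn h (↑J : Set ι)) {C : ℝ}
    (hhC : ∀ x, |h x| ≤ C) : (∫ x, h x ∂μ₁) * μ₂.real univ ≤ μ₁.real univ * ∫ x, h x ∂μ₂ := by
  have hhm : Measurable h := measurable_of_dependsOn hhd
  -- the level sets `{h > t}` are local increasing events
  refine integral_mul_le_mul_integral_of_levelSets μ₁ μ₂ hhm hhC fun t => ?_
  exact holley_local_upperSet_of_crossBox_spin μ₁ μ₂ hcross J (fun x y hxy hx => lt_of_lt_of_le hx (hh hxy))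
    (measurableSet_lt measurable_const hhm) fun x y hxy => by
      have : h x = h y := hhd hxy
      simp only [mem_setOf_eq, this]

/-- **HOLLEY'S INEQUALITY ON `{−1,+1}^ι`, DENSITY-FREE, LOCAL FUNCTIONALS**: probability measures `μ₁, μ₂` with
`μ₁[a,b] μ₂[a',b'] ≤ μ₁[a ∧ a', b ∧ b'] μ₂[a ∨ a', b ∨ b']` for all order boxes satisfy `∫ h dμ₁ ≤ ∫ h dμ₂` for every
bounded increasing functional `h` of finitely many spins. [this work] -/
theorem holley_local_of_crossBox_spin (μ₁ μ₂ : Measure (ι → ℤˣ)) [IsProbabilityMeasure μ₁] [IsProbabilityMeasure μ₂]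
    (hcross : ∀ a b a' b' : ι → ℤˣ,
      μ₁ (Icc a b) * μ₂ (Icc a' b') ≤ μ₁ (Icc (a ⊓ a') (b ⊓ b')) * μ₂ (Icc (a ⊔ a') (b ⊔ b')))
    (J : Finset ι) {h : (ι → ℤˣ) → ℝ} (hh : Monotone h) (hhd : DependsOn h (↑J : Set ι)) {C : ℝ}
    (hhC : ∀ x, |h x| ≤ C) : ∫ x, h x ∂μ₁ ≤ ∫ x, h x ∂μ₂ := by
  simpa only [probReal_univ, mul_one, one_mul] using
    holley_local_integral_of_crossBox_spin μ₁ μ₂ hcross J hh hhd hhC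

end Spins

end Summit.CriticalPhenomena.PercolationContinuityZ3.Theorems.SahiBoxTP2
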